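import Mathlib
import Summits.Ventures.PercRepro2.K5Kernel
import Summits.Ventures.PercRepro2.K5Conn
import Summits.Ventures.PercRepro2.K5Kron
import Summits.Ventures.PercRepro2.K5Digits
import Summits.Ventures.PercRepro2.PMK5Kernel

/-!
# The bridge of the `K₅` (PM) certificates: the tables are the tree's events, and every tensor-Bernstein
coefficient of the cleared `(HALF-PM⁺)_L`, `(HALF-PM⁺)_H`, `(C4)` is `≥ 0`
(blind cell PercRepro2, mine-2 g22; row 2′BETA1; the first bridge file after `PMK5Kernel.lean`)

* **Tables.**  Each table of `PMK5Kernel.lean` (and `K5.tQ`, `K5.tQBL`, `K5.tQB`) is the indicator of the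
  corresponding event of the tree on `K5.ends5` — `Q = (connEvent ends5 1 2)ᶜ`, `{b ∈ C₁} = connEvent ends5 1 4`,
  `{u ∈ C₂} = connEvent ends5 2 3`, `{o ∈ C₁ ∪ C₂} = connEvent ends5 1 0 ∪ connEvent ends5 2 0`, … — written
  with `Q` LAST, the order of the per-side brackets in `CutMixedPM.lean` / `RootPairSepPM.lean`
  (`K5Conn.conn_iff_mem`).
* **Digits.**  `kPosL = Σ_k cntPosL k · KB^{idx4 k}` with `cntPosL k` the sum of the three positive triple
  counts `K5.cnt3` of profile `k` (`K5Kron.kron_eq_kronSum`, `K5Kron.kronSum_mul_mul`), likewise `kNegL`, and the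
  counts are `≤ 3 · 3^10 < 2^19`; the digit argument `K5Digits.le_of_kron_le` turns the kernel certificate
  `PM.certL` into `cntNegL k ≤ cntPosL k` for every profile `k` — every degree-3 tensor-Bernstein coefficient of
  the cleared `(HALF-PM⁺)_L` on `K₅` is `≥ 0` (`cntNegL_le_cntPosL`); the same for `H` and `(C4)`.
The theorems for every weight vector are in `PMK5Theorem.lean`.
-/

namespace Summit.Ventures.PercRepro2

namespace K5

namespace PM

/-! ## The tables are the tree's events -/

section Tables

/-- `tQ ω ↔ ω ∈ Q = {a₁ ↮ a₂}`, as the complement of the connection event. -/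
lemma tQ_iff_compl (ω : Fin 10 → Bool) : tQ ω = true ↔ ω ∈ (connEvent ends5 1 2)ᶜ := by
  unfold tQ
  rw [Bool.not_eq_true', Bool.eq_false_iff, Ne, conn_iff_mem ω (by norm_num) (by norm_num)]
  exact Iff.rfl

/-- `tQBL ω ↔ ω ∈ {b ∈ C₁} ∩ Q`. -/
lemma tQBL_iff' (ω : Fin 10 → Bool) :
    tQBL ω = true ↔ ω ∈ connEvent ends5 1 4 ∩ (connEvent ends5 1 2)ᶜ := by
  unfold tQBL
  rw [Bool.and_eq_true, tQ_iff_compl, conn_iff_mem ω (by norm_num) (by norm_num)]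
  simp only [Set.mem_inter_iff]; tauto

/-- `tQB ω ↔ ω ∈ {b ∈ C₂} ∩ Q`. -/
lemma tQB_iff' (ω : Fin 10 → Bool) :
    tQB ω = true ↔ ω ∈ connEvent ends5 2 4 ∩ (connEvent ends5 1 2)ᶜ := by
  unfold tQB
  rw [Bool.and_eq_true, tQ_iff_compl, conn_iff_mem ω (by norm_num) (by norm_num)]
  simp only [Set.mem_inter_iff]; tauto

/-- `tQHu ω ↔ ω ∈ {u ∈ C₂} ∩ Q`. -/
lemma tQHu_iff (ω : Fin 10 → Bool) :
    tQHu ω = true ↔ ω ∈ connEvent ends5 2 3 ∩ (connEvent ends5 1 2)ᶜ := by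
  unfold tQHu
  rw [Bool.and_eq_true, tQ_iff_compl, conn_iff_mem ω (by norm_num) (by norm_num)]
  simp only [Set.mem_inter_iff]; tauto

/-- `tQoU ω ↔ ω ∈ {o ∈ C₁ ∪ C₂} ∩ Q`. -/
lemma tQoU_iff (ω : Fin 10 → Bool) :
    tQoU ω = true ↔ ω ∈ (connEvent ends5 1 0 ∪ connEvent ends5 2 0) ∩ (connEvent ends5 1 2)ᶜ := by
  unfold tQoU
  rw [Bool.and_eq_true, Bool.or_eq_true, tQ_iff_compl, conn_iff_mem ω (by norm_num) (by norm_num),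
    conn_iff_mem ω (by norm_num) (by norm_num)]
  simp only [Set.mem_inter_iff, Set.mem_union]; tauto

/-- `tQBLHuoU ω ↔ ω ∈ {b ∈ C₁} ∩ {u ∈ C₂} ∩ {o ∈ C₁ ∪ C₂} ∩ Q`. -/
lemma tQBLHuoU_iff (ω : Fin 10 → Bool) :
    tQBLHuoU ω = true ↔ ω ∈ connEvent ends5 1 4 ∩ connEvent ends5 2 3 ∩
      (connEvent ends5 1 0 ∪ connEvent ends5 2 0) ∩ (connEvent ends5 1 2)ᶜ := by
  unfold tQBLHuoU
  rw [Bool.and_eq_true, Bool.and_eq_true, Bool.and_eq_true, Bool.or_eq_true, tQ_iff_compl,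
    conn_iff_mem ω (by norm_num) (by norm_num), conn_iff_mem ω (by norm_num) (by norm_num),
    conn_iff_mem ω (by norm_num) (by norm_num), conn_iff_mem ω (by norm_num) (by norm_num)]
  simp only [Set.mem_inter_iff, Set.mem_union]; tauto

/-- `tQHuoU ω ↔ ω ∈ {u ∈ C₂} ∩ {o ∈ C₁ ∪ C₂} ∩ Q`. -/
lemma tQHuoU_iff (ω : Fin 10 → Bool) :
    tQHuoU ω = true ↔ ω ∈ connEvent ends5 2 3 ∩ (connEvent ends5 1 0 ∪ connEvent ends5 2 0) ∩
      (connEvent ends5 1 2)ᶜ := by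
  unfold tQHuoU
  rw [Bool.and_eq_true, Bool.and_eq_true, Bool.or_eq_true, tQ_iff_compl,
    conn_iff_mem ω (by norm_num) (by norm_num), conn_iff_mem ω (by norm_num) (by norm_num),
    conn_iff_mem ω (by norm_num) (by norm_num)]
  simp only [Set.mem_inter_iff, Set.mem_union]; tauto

/-- `tQBLHu ω ↔ ω ∈ {b ∈ C₁} ∩ {u ∈ C₂} ∩ Q`. -/
lemma tQBLHu_iff (ω : Fin 10 → Bool) :
    tQBLHu ω = true ↔ ω ∈ connEvent ends5 1 4 ∩ connEvent ends5 2 3 ∩ (connEvent ends5 1 2)ᶜ := by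
  unfold tQBLHu
  rw [Bool.and_eq_true, Bool.and_eq_true, tQ_iff_compl, conn_iff_mem ω (by norm_num) (by norm_num),
    conn_iff_mem ω (by norm_num) (by norm_num)]
  simp only [Set.mem_inter_iff]; tauto

/-- `tQBLHo ω ↔ ω ∈ {b ∈ C₁} ∩ {o ∈ C₂} ∩ Q`. -/
lemma tQBLHo_iff (ω : Fin 10 → Bool) :
    tQBLHo ω = true ↔ ω ∈ connEvent ends5 1 4 ∩ connEvent ends5 2 0 ∩ (connEvent ends5 1 2)ᶜ := by
  unfold tQBLHo
  rw [Bool.and_eq_true, Bool.and_eq_true, tQ_iff_compl, conn_iff_mem ω (by norm_num) (by norm_num),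
    conn_iff_mem ω (by norm_num) (by norm_num)]
  simp only [Set.mem_inter_iff]; tauto

/-- `tQHo ω ↔ ω ∈ {o ∈ C₂} ∩ Q`. -/
lemma tQHo_iff (ω : Fin 10 → Bool) :
    tQHo ω = true ↔ ω ∈ connEvent ends5 2 0 ∩ (connEvent ends5 1 2)ᶜ := by
  unfold tQHo
  rw [Bool.and_eq_true, tQ_iff_compl, conn_iff_mem ω (by norm_num) (by norm_num)]
  simp only [Set.mem_inter_iff]; tauto

/-- `tQLo ω ↔ ω ∈ {o ∈ C₁} ∩ Q`. -/
lemma tQLo_iff (ω : Fin 10 → Bool) :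
    tQLo ω = true ↔ ω ∈ connEvent ends5 1 0 ∩ (connEvent ends5 1 2)ᶜ := by
  unfold tQLo
  rw [Bool.and_eq_true, tQ_iff_compl, conn_iff_mem ω (by norm_num) (by norm_num)]
  simp only [Set.mem_inter_iff]; tauto

/-- `tQBLHuLo ω ↔ ω ∈ {b ∈ C₁} ∩ {u ∈ C₂} ∩ {o ∈ C₁} ∩ Q`. -/
lemma tQBLHuLo_iff (ω : Fin 10 → Bool) :
    tQBLHuLo ω = true ↔ ω ∈ connEvent ends5 1 4 ∩ connEvent ends5 2 3 ∩ connEvent ends5 1 0 ∩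
      (connEvent ends5 1 2)ᶜ := by
  unfold tQBLHuLo
  rw [Bool.and_eq_true, Bool.and_eq_true, Bool.and_eq_true, tQ_iff_compl,
    conn_iff_mem ω (by norm_num) (by norm_num), conn_iff_mem ω (by norm_num) (by norm_num),
    conn_iff_mem ω (by norm_num) (by norm_num)]
  simp only [Set.mem_inter_iff]; tauto

/-- `tQHuLo ω ↔ ω ∈ {u ∈ C₂} ∩ {o ∈ C₁} ∩ Q`. -/
lemma tQHuLo_iff (ω : Fin 10 → Bool) :
    tQHuLo ω = true ↔ ω ∈ connEvent ends5 2 3 ∩ connEvent ends5 1 0 ∩ (connEvent ends5 1 2)ᶜ := by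
  unfold tQHuLo
  rw [Bool.and_eq_true, Bool.and_eq_true, tQ_iff_compl, conn_iff_mem ω (by norm_num) (by norm_num),
    conn_iff_mem ω (by norm_num) (by norm_num)]
  simp only [Set.mem_inter_iff]; tauto

/-- `tQLu ω ↔ ω ∈ {u ∈ C₁} ∩ Q`. -/
lemma tQLu_iff (ω : Fin 10 → Bool) :
    tQLu ω = true ↔ ω ∈ connEvent ends5 1 3 ∩ (connEvent ends5 1 2)ᶜ := by
  unfold tQLu
  rw [Bool.and_eq_true, tQ_iff_compl, conn_iff_mem ω (by norm_num) (by norm_num)]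
  simp only [Set.mem_inter_iff]; tauto

/-- `tQBLuoU ω ↔ ω ∈ {b ∈ C₂} ∩ {u ∈ C₁} ∩ {o ∈ C₁ ∪ C₂} ∩ Q`. -/
lemma tQBLuoU_iff (ω : Fin 10 → Bool) :
    tQBLuoU ω = true ↔ ω ∈ connEvent ends5 2 4 ∩ connEvent ends5 1 3 ∩
      (connEvent ends5 1 0 ∪ connEvent ends5 2 0) ∩ (connEvent ends5 1 2)ᶜ := by
  unfold tQBLuoU
  rw [Bool.and_eq_true, Bool.and_eq_true, Bool.and_eq_true, Bool.or_eq_true, tQ_iff_compl,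
    conn_iff_mem ω (by norm_num) (by norm_num), conn_iff_mem ω (by norm_num) (by norm_num),
    conn_iff_mem ω (by norm_num) (by norm_num), conn_iff_mem ω (by norm_num) (by norm_num)]
  simp only [Set.mem_inter_iff, Set.mem_union]; tauto

/-- `tQLuoU ω ↔ ω ∈ {u ∈ C₁} ∩ {o ∈ C₁ ∪ C₂} ∩ Q`. -/
lemma tQLuoU_iff (ω : Fin 10 → Bool) :
    tQLuoU ω = true ↔ ω ∈ connEvent ends5 1 3 ∩ (connEvent ends5 1 0 ∪ connEvent ends5 2 0) ∩
      (connEvent ends5 1 2)ᶜ := by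
  unfold tQLuoU
  rw [Bool.and_eq_true, Bool.and_eq_true, Bool.or_eq_true, tQ_iff_compl,
    conn_iff_mem ω (by norm_num) (by norm_num), conn_iff_mem ω (by norm_num) (by norm_num),
    conn_iff_mem ω (by norm_num) (by norm_num)]
  simp only [Set.mem_inter_iff, Set.mem_union]; tauto

/-- `tQBLu ω ↔ ω ∈ {b ∈ C₂} ∩ {u ∈ C₁} ∩ Q`. -/
lemma tQBLu_iff (ω : Fin 10 → Bool) :
    tQBLu ω = true ↔ ω ∈ connEvent ends5 2 4 ∩ connEvent ends5 1 3 ∩ (connEvent ends5 1 2)ᶜ := by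
  unfold tQBLu
  rw [Bool.and_eq_true, Bool.and_eq_true, tQ_iff_compl, conn_iff_mem ω (by norm_num) (by norm_num),
    conn_iff_mem ω (by norm_num) (by norm_num)]
  simp only [Set.mem_inter_iff]; tauto

/-- `tQBLo ω ↔ ω ∈ {b ∈ C₂} ∩ {o ∈ C₁} ∩ Q`. -/
lemma tQBLo_iff (ω : Fin 10 → Bool) :
    tQBLo ω = true ↔ ω ∈ connEvent ends5 2 4 ∩ connEvent ends5 1 0 ∩ (connEvent ends5 1 2)ᶜ := by
  unfold tQBLo
  rw [Bool.and_eq_true, Bool.and_eq_true, tQ_iff_compl, conn_iff_mem ω (by norm_num) (by norm_num),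
    conn_iff_mem ω (by norm_num) (by norm_num)]
  simp only [Set.mem_inter_iff]; tauto

end Tables

/-! ## From the kernel certificates to the coefficient inequalities -/

section Digits

/-- The positive triple counts of the cleared `(HALF-PM⁺)_L`. -/
def cntPosL (k : Fin 10 → Fin 4) : ℕ :=
  cnt3 tQBLHuoU tQ tQ k + cnt3 tQBL tQHu tQoU k + cnt3 tQBL tQHo tQ k

/-- The negative triple counts of the cleared `(HALF-PM⁺)_L`. -/
def cntNegL (k : Fin 10 → Fin 4) : ℕ :=
  cnt3 tQBL tQHuoU tQ k + cnt3 tQoU tQ tQBLHu k + cnt3 tQ tQ tQBLHo k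

/-- The positive triple counts of the cleared `(HALF-PM⁺)_H`. -/
def cntPosH (k : Fin 10 → Fin 4) : ℕ :=
  cnt3 tQBLuoU tQ tQ k + cnt3 tQB tQLu tQoU k + cnt3 tQB tQLo tQ k

/-- The negative triple counts of the cleared `(HALF-PM⁺)_H`. -/
def cntNegH (k : Fin 10 → Fin 4) : ℕ :=
  cnt3 tQB tQLuoU tQ k + cnt3 tQoU tQ tQBLu k + cnt3 tQ tQ tQBLo k

/-- The positive triple counts of the cleared `(C4)`. -/
def cntPosC4 (k : Fin 10 → Fin 4) : ℕ := cnt3 tQBLHuLo tQ tQ k + cnt3 tQBL tQHu tQoU k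

/-- The negative triple counts of the cleared `(C4)`. -/
def cntNegC4 (k : Fin 10 → Fin 4) : ℕ := cnt3 tQBL tQHuLo tQ k + cnt3 tQoU tQ tQBLHu k

/-- Three Kronecker sums combine (coefficient functions as variables, as in `K5.sum_add_mul5`). -/
lemma sum_add_add_mul5 (f g h : (Fin 10 → Fin 4) → ℕ) :
    ∑ k, f k * KB ^ idx4 k + ∑ k, g k * KB ^ idx4 k + ∑ k, h k * KB ^ idx4 k =
      ∑ k, (f k + g k + h k) * KB ^ idx4 k := by
  rw [sum_add_mul5, sum_add_mul5]

/-- `kPosL` carries the positive counts. -/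
lemma kPosL_eq : kPosL = ∑ k, cntPosL k * KB ^ idx4 k :=
  calc kPosL = kronSum tQBLHuoU * kronSum tQ * kronSum tQ + kronSum tQBL * kronSum tQHu * kronSum tQoU +
        kronSum tQBL * kronSum tQHo * kronSum tQ := by
        unfold kPosL
        rw [kron_eq_kronSum tQBLHuoU, kron_eq_kronSum tQ, kron_eq_kronSum tQBL, kron_eq_kronSum tQHu,
          kron_eq_kronSum tQoU, kron_eq_kronSum tQHo]
    _ = ∑ k, cnt3 tQBLHuoU tQ tQ k * KB ^ idx4 k + ∑ k, cnt3 tQBL tQHu tQoU k * KB ^ idx4 k +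
        ∑ k, cnt3 tQBL tQHo tQ k * KB ^ idx4 k := by
        rw [kronSum_mul_mul, kronSum_mul_mul, kronSum_mul_mul]
    _ = ∑ k, cntPosL k * KB ^ idx4 k := sum_add_add_mul5 _ _ _

/-- `kNegL` carries the negative counts. -/
lemma kNegL_eq : kNegL = ∑ k, cntNegL k * KB ^ idx4 k :=
  calc kNegL = kronSum tQBL * kronSum tQHuoU * kronSum tQ + kronSum tQoU * kronSum tQ * kronSum tQBLHu +
        kronSum tQ * kronSum tQ * kronSum tQBLHo := by
        unfold kNegL
        rw [kron_eq_kronSum tQBL, kron_eq_kronSum tQHuoU, kron_eq_kronSum tQ, kron_eq_kronSum tQoU,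
          kron_eq_kronSum tQBLHu, kron_eq_kronSum tQBLHo]
    _ = ∑ k, cnt3 tQBL tQHuoU tQ k * KB ^ idx4 k + ∑ k, cnt3 tQoU tQ tQBLHu k * KB ^ idx4 k +
        ∑ k, cnt3 tQ tQ tQBLHo k * KB ^ idx4 k := by
        rw [kronSum_mul_mul, kronSum_mul_mul, kronSum_mul_mul]
    _ = ∑ k, cntNegL k * KB ^ idx4 k := sum_add_add_mul5 _ _ _

/-- `kPosH` carries the positive counts. -/
lemma kPosH_eq : kPosH = ∑ k, cntPosH k * KB ^ idx4 k :=
  calc kPosH = kronSum tQBLuoU * kronSum tQ * kronSum tQ + kronSum tQB * kronSum tQLu * kronSum tQoU +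
        kronSum tQB * kronSum tQLo * kronSum tQ := by
        unfold kPosH
        rw [kron_eq_kronSum tQBLuoU, kron_eq_kronSum tQ, kron_eq_kronSum tQB, kron_eq_kronSum tQLu,
          kron_eq_kronSum tQoU, kron_eq_kronSum tQLo]
    _ = ∑ k, cnt3 tQBLuoU tQ tQ k * KB ^ idx4 k + ∑ k, cnt3 tQB tQLu tQoU k * KB ^ idx4 k +
        ∑ k, cnt3 tQB tQLo tQ k * KB ^ idx4 k := by
        rw [kronSum_mul_mul, kronSum_mul_mul, kronSum_mul_mul]
    _ = ∑ k, cntPosH k * KB ^ idx4 k := sum_add_add_mul5 _ _ _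

/-- `kNegH` carries the negative counts. -/
lemma kNegH_eq : kNegH = ∑ k, cntNegH k * KB ^ idx4 k :=
  calc kNegH = kronSum tQB * kronSum tQLuoU * kronSum tQ + kronSum tQoU * kronSum tQ * kronSum tQBLu +
        kronSum tQ * kronSum tQ * kronSum tQBLo := by
        unfold kNegH
        rw [kron_eq_kronSum tQB, kron_eq_kronSum tQLuoU, kron_eq_kronSum tQ, kron_eq_kronSum tQoU,
          kron_eq_kronSum tQBLu, kron_eq_kronSum tQBLo]
    _ = ∑ k, cnt3 tQB tQLuoU tQ k * KB ^ idx4 k + ∑ k, cnt3 tQoU tQ tQBLu k * KB ^ idx4 k +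
        ∑ k, cnt3 tQ tQ tQBLo k * KB ^ idx4 k := by
        rw [kronSum_mul_mul, kronSum_mul_mul, kronSum_mul_mul]
    _ = ∑ k, cntNegH k * KB ^ idx4 k := sum_add_add_mul5 _ _ _

/-- `kPosC4` carries the positive counts. -/
lemma kPosC4_eq : kPosC4 = ∑ k, cntPosC4 k * KB ^ idx4 k :=
  calc kPosC4 = kronSum tQBLHuLo * kronSum tQ * kronSum tQ + kronSum tQBL * kronSum tQHu * kronSum tQoU := by
        unfold kPosC4
        rw [kron_eq_kronSum tQBLHuLo, kron_eq_kronSum tQ, kron_eq_kronSum tQBL, kron_eq_kronSum tQHu,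
          kron_eq_kronSum tQoU]
    _ = ∑ k, cnt3 tQBLHuLo tQ tQ k * KB ^ idx4 k + ∑ k, cnt3 tQBL tQHu tQoU k * KB ^ idx4 k := by
        rw [kronSum_mul_mul, kronSum_mul_mul]
    _ = ∑ k, cntPosC4 k * KB ^ idx4 k := sum_add_mul5 _ _

/-- `kNegC4` carries the negative counts. -/
lemma kNegC4_eq : kNegC4 = ∑ k, cntNegC4 k * KB ^ idx4 k :=
  calc kNegC4 = kronSum tQBL * kronSum tQHuLo * kronSum tQ + kronSum tQoU * kronSum tQ * kronSum tQBLHu := by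
        unfold kNegC4
        rw [kron_eq_kronSum tQBL, kron_eq_kronSum tQHuLo, kron_eq_kronSum tQ, kron_eq_kronSum tQoU,
          kron_eq_kronSum tQBLHu]
    _ = ∑ k, cnt3 tQBL tQHuLo tQ k * KB ^ idx4 k + ∑ k, cnt3 tQoU tQ tQBLHu k * KB ^ idx4 k := by
        rw [kronSum_mul_mul, kronSum_mul_mul]
    _ = ∑ k, cntNegC4 k * KB ^ idx4 k := sum_add_mul5 _ _

/-- The counts are bounded by `3 · 3^10 < 2^19`. -/
lemma cntPosL_lt (k : Fin 10 → Fin 4) : cntPosL k < 2 ^ 19 := by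
  unfold cntPosL
  have := cnt3_le tQBLHuoU tQ tQ k
  have := cnt3_le tQBL tQHu tQoU k
  have := cnt3_le tQBL tQHo tQ k
  omega

/-- The counts are bounded by `3 · 3^10 < 2^19`. -/
lemma cntNegL_lt (k : Fin 10 → Fin 4) : cntNegL k < 2 ^ 19 := by
  unfold cntNegL
  have := cnt3_le tQBL tQHuoU tQ k
  have := cnt3_le tQoU tQ tQBLHu k
  have := cnt3_le tQ tQ tQBLHo k
  omega

/-- The counts are bounded by `3 · 3^10 < 2^19`. -/
lemma cntPosH_lt (k : Fin 10 → Fin 4) : cntPosH k < 2 ^ 19 := by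
  unfold cntPosH
  have := cnt3_le tQBLuoU tQ tQ k
  have := cnt3_le tQB tQLu tQoU k
  have := cnt3_le tQB tQLo tQ k
  omega

/-- The counts are bounded by `3 · 3^10 < 2^19`. -/
lemma cntNegH_lt (k : Fin 10 → Fin 4) : cntNegH k < 2 ^ 19 := by
  unfold cntNegH
  have := cnt3_le tQB tQLuoU tQ k
  have := cnt3_le tQoU tQ tQBLu k
  have := cnt3_le tQ tQ tQBLo k
  omega

/-- The counts are bounded by `2 · 3^10 < 2^19`. -/
lemma cntPosC4_lt (k : Fin 10 → Fin 4) : cntPosC4 k < 2 ^ 19 := by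
  unfold cntPosC4
  have := cnt3_le tQBLHuLo tQ tQ k
  have := cnt3_le tQBL tQHu tQoU k
  omega

/-- The counts are bounded by `2 · 3^10 < 2^19`. -/
lemma cntNegC4_lt (k : Fin 10 → Fin 4) : cntNegC4 k < 2 ^ 19 := by
  unfold cntNegC4
  have := cnt3_le tQBL tQHuLo tQ k
  have := cnt3_le tQoU tQ tQBLHu k
  omega

/-- **Every Bernstein coefficient of the cleared `(HALF-PM⁺)_L` is `≥ 0`** (from the kernel certificate). -/
theorem cntNegL_le_cntPosL (k : Fin 10 → Fin 4) : cntNegL k ≤ cntPosL k :=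
  le_of_kron_le cntPosL cntNegL cntPosL_lt cntNegL_lt kPosL_eq kNegL_eq certL.1 certL.2.1 k

/-- **Every Bernstein coefficient of the cleared `(HALF-PM⁺)_H` is `≥ 0`** (from the kernel certificate). -/
theorem cntNegH_le_cntPosH (k : Fin 10 → Fin 4) : cntNegH k ≤ cntPosH k :=
  le_of_kron_le cntPosH cntNegH cntPosH_lt cntNegH_lt kPosH_eq kNegH_eq certH.1 certH.2.1 k

/-- **Every Bernstein coefficient of the cleared `(C4)` is `≥ 0`** (from the kernel certificate). -/
theorem cntNegC4_le_cntPosC4 (k : Fin 10 → Fin 4) : cntNegC4 k ≤ cntPosC4 k :=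
  le_of_kron_le cntPosC4 cntNegC4 cntPosC4_lt cntNegC4_lt kPosC4_eq kNegC4_eq certC4.1 certC4.2.1 k


/-- The three coefficient inequalities at once (the form consumed by `PMK5Typed.lean`). -/
theorem cntNeg_le_cntPos_all (k : Fin 10 → Fin 4) :
    cntNegL k ≤ cntPosL k ∧ cntNegH k ≤ cntPosH k ∧ cntNegC4 k ≤ cntPosC4 k :=
  ⟨cntNegL_le_cntPosL k, cntNegH_le_cntPosH k, cntNegC4_le_cntPosC4 k⟩

end Digits

end PM

end K5

end Summit.Ventures.PercRepro2
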